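import Literature.AnabelianGeometry.AbsoluteAnabelian.DiagramMorphismsAutGroup
import Literature.AnabelianGeometry.AbsoluteAnabelian.RigidFunctors
import HarnessLib

/-!
# [AbsTopIII] Def 3.5 (v) p.77: the two RIGIDITY sentences — edge-rigid diagrams have their
# equivalences determined by `Φ_Γ⃗` and the `Φ_v`; vertex-rigid diagrams have unique 2-isomorphisms

S. Mochizuki, *Topics in absolute anabelian geometry III*, J. Math. Sci. Univ. Tokyo 22 (2015)
[MochizukiAbsTopIII2015], Definition 3.5 (v) p.77 (manuscript pages, lit key
`paper:url-5493eb38cbb7`), verbatim: "Thus, if `𝒟` is edge-rigid, then any equivalence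
`Φ : 𝒟 ⥲ 𝒟'` is *completely determined* by `Φ_Γ⃗` and the `{Φ_v}` [i.e., the data (a), (b) in the
above definition].  In a similar vein, if `𝒟` is vertex-rigid, then any two isomorphic equivalences
`Φ, Ψ : 𝒟 ⥲ 𝒟'` admit a *unique* [2-]isomorphism `Φ ⥲ Ψ`.  In particular, if `𝒟` is vertex-rigid,
then it is natural to speak of the *automorphism group* `Aut(𝒟)` of `𝒟`."

PROOF-ONLY companion (no definition, no instance, nothing restated) of `DiagramMorphisms.lean`
(abc-iut-L4-t2: `OneMorphism`, `TwoMorphism`, `IsEquivalence`, `IsVertexRigid`, `IsEdgeRigid`,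
`SelfEquivalence`, `Aut`), `RigidFunctors.lean` (`isRigidFunctor_of_full_faithful`,
`IsRigidFunctor.hom_app_eq_id`) and `DiagramMorphismsAutGroup.lean` (abc-iut-f-095 gen 2:
`Aut.mk`, `Aut.mk_eq_mk`, the group `Aut(𝒟)` for every `𝒟`).  Both printed sentences become
theorems here, over Mathlib's `Functor.IsEquivalence` / `Full` / `Faithful` / `EssSurj` calculus:

* `OneMorphism.IsEquivalence.isEquivalence_app` — the vertex functors `Φ_v` of an equivalence OF
  DIAGRAMS are equivalences OF CATEGORIES (two-sided quasi-inverses vertexwise, read off the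
  quasi-inverse 1-morphism after transport along `Ψ_Γ⃗ ∘ Φ_Γ⃗ = id`);
* `IsRigidFunctor.comp_full_faithful` — a rigid functor followed by a fully faithful functor is
  rigid (the automorphism descends along the fully faithful functor);
* **edge-rigidity** (`OneMorphism.ext_of_isEdgeRigid`, `OneMorphism.IsEquivalence.ext_of_isEdgeRigid`,
  `SelfEquivalence.ext_of_isEdgeRigid`): over an edge-rigid `𝒟`, two 1-morphisms over the same
  `Φ_Γ⃗` with the same vertex functors, one of them an equivalence (fully faithful vertex functors
  suffice), are EQUAL — the edge 2-cells `Φ_e : 𝒟'_{Φe} ∘ Φ_{v₁} ⥲ Φ_{v₂} ∘ 𝒟_e` are forced, since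
  two of them differ by an automorphism of `𝒟_e ⋙ Φ_{v₂}`, a rigid functor;
* **vertex-rigidity** (`TwoMorphism.IsIso.app_eq_id_of_isVertexRigid`,
  `TwoMorphism.IsIso.eq_of_isVertexRigid`, `OneMorphism.Isomorphic.existsUnique_of_isVertexRigid`,
  `Aut.existsUnique_twoIso_of_mk_eq`): over a vertex-rigid `𝒟`, every 2-automorphism of an
  equivalence is the identity, any two 2-isomorphisms `Φ ⥲ Ψ` out of an equivalence coincide, so
  isomorphic equivalences admit a UNIQUE 2-isomorphism, and two self-equivalences with the same
  class in `Aut(𝒟)` are related by a unique 2-isomorphism ("natural to speak of `Aut(𝒟)`").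

abc-iut cell, seat abc-iut-f-095 (gen 3; by-name completion of the Def 3.5 (v) lineage of FACT-LIST
rows F-0092/F-0093 — no binder of any certificate changes).  Pure category theory; nothing here
bears on the disputed [IUTchIII] Cor. 3.12 or takes a side; typed ≠ proved elsewhere.
-/

namespace Literature.AnabelianGeometry.AbsoluteAnabelian

open _root_.CategoryTheory _root_.Quiver

universe v u w

/-! ### §0 "Categories": one more closure property of rigid functors -/

section Rigid

variable {C : Type u} [Category.{v} C] {C' : Type u} [Category.{v} C'] {C'' : Type u}
  [Category.{v} C'']

/-- **A rigid functor followed by a fully faithful functor is rigid**: an automorphism of `K ⋙ G`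
has components in the image of `G` (fullness), which form — by faithfulness — an automorphism of
`K`, hence are identities.  (For `K = 𝟭` this is `isRigidFunctor_of_full_faithful`.)
[cite: MochizukiAbsTopIII2015, Section 0 p.27] -/
theorem IsRigidFunctor.comp_full_faithful {K : C ⥤ C'} (hK : IsRigidFunctor K) (G : C' ⥤ C'')
    [G.Full] [G.Faithful] : IsRigidFunctor (K ⋙ G) := by
  refine isRigidFunctor_of_hom_app_eq_id fun α x => ?_
  let β : K ≅ K := NatIso.ofComponents (fun y => G.preimageIso (α.app y))
    (fun {y z} f => G.map_injective (by
      simp only [Functor.map_comp, Functor.preimageIso_hom, Iso.app_hom, Functor.map_preimage]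
      exact α.hom.naturality f))
  have hβ := hK.hom_app_eq_id β x
  simp only [β, NatIso.ofComponents_hom_app, Functor.preimageIso_hom, Iso.app_hom] at hβ
  have hβ' : G.preimage (α.hom.app x) = 𝟙 (K.obj x) := hβ
  have h : G.map (G.preimage (α.hom.app x)) = G.map (𝟙 (K.obj x)) := by rw [hβ']
  rw [G.map_preimage, G.map_id] at h
  exact h

end Rigid

namespace DiagramOfCategories

variable {V : Type w} [Quiver.{v} V] {V' : Type w} [Quiver.{v} V']
  {F : V ⥤q V'} {D : DiagramOfCategories.{v, u, w} V} {D' : DiagramOfCategories.{v, u, w} V'}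

/-! ### The vertex functors of an equivalence of diagrams are equivalences of categories -/

/-- A 1-morphism `Ξ : 𝒟 → 𝒟` over a morphism of graphs EQUAL to the identity, and 2-isomorphic
(after transport along that equality) to `id_𝒟`, has vertex functors that are equivalences of
categories (each `Ξ_v ≅ 𝟭_{𝒟_v}`).  [cite: MochizukiAbsTopIII2015, Definition 3.5 (v) p.76] -/
theorem OneMorphism.isEquivalence_app_of_isomorphic_id {E : V ⥤q V} (Ξ : OneMorphism E D D)
    (hE : E = 𝟭q V) (h : (hE ▸ Ξ).Isomorphic (OneMorphism.id D)) (a : V) :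
    (Ξ.app a).IsEquivalence := by
  subst hE
  obtain ⟨Θ, hΘ⟩ := h
  haveI := hΘ a
  haveI : ((OneMorphism.id D).app a).IsEquivalence := Functor.isEquivalence_refl
  exact Functor.isEquivalence_of_iso (asIso (Θ.app a)).symm

/-- **The vertex functors `Φ_v` of an equivalence of diagrams of categories are equivalences of
categories.**  If `Ψ` is a quasi-inverse of `Φ` over `Ψ_Γ⃗` (`Ψ_Γ⃗ ∘ Φ_Γ⃗ = id`, `Φ_Γ⃗ ∘ Ψ_Γ⃗ = id`),
then `Ψ_{Φ_Γ⃗ v} ∘ Φ_v ≅ 𝟭` and `Φ_{Ψ_Γ⃗ Φ_Γ⃗ v} ∘ Ψ_{Φ_Γ⃗ v} ≅ 𝟭` with `Ψ_Γ⃗ Φ_Γ⃗ v = v`, whence `Φ_v`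
is faithful, full and essentially surjective. [cite: MochizukiAbsTopIII2015, Definition 3.5 (v) pp.76–77] -/
theorem OneMorphism.IsEquivalence.isEquivalence_app {Φ : OneMorphism F D D'}
    (hΦ : Φ.IsEquivalence) (a : V) : (Φ.app a).IsEquivalence := by
  obtain ⟨G, Ψ, h₁, h₂, i₁, i₂⟩ := hΦ
  have e₁ : (Φ.app a ⋙ Ψ.app (F.obj a)).IsEquivalence :=
    OneMorphism.isEquivalence_app_of_isomorphic_id (Φ.comp Ψ) h₁ i₁ a
  have e₂ : (Ψ.app (F.obj a) ⋙ Φ.app (G.obj (F.obj a))).IsEquivalence :=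
    OneMorphism.isEquivalence_app_of_isomorphic_id (Ψ.comp Φ) h₂ i₂ (F.obj a)
  have ha : G.obj (F.obj a) = a := congrArg (fun P : V ⥤q V => P.obj a) h₁
  have hfaithful : (Φ.app a).Faithful := Functor.Faithful.of_comp (Φ.app a) (Ψ.app (F.obj a))
  have hΨ : (Ψ.app (F.obj a)).Faithful :=
    Functor.Faithful.of_comp (Ψ.app (F.obj a)) (Φ.app (G.obj (F.obj a)))
  have hfull : (Φ.app a).Full := Functor.Full.of_comp_faithful (Φ.app a) (Ψ.app (F.obj a))
  have hess' : (Φ.app (G.obj (F.obj a))).EssSurj :=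
    { mem_essImage := fun Y =>
        ⟨_, ⟨(Ψ.app (F.obj a) ⋙ Φ.app (G.obj (F.obj a))).objObjPreimageIso Y⟩⟩ }
  have hess : (Φ.app a).EssSurj := ha ▸ hess'
  exact Functor.IsEquivalence.mk hfaithful hfull hess

/-- The vertex functors of a self-equivalence are equivalences of categories.
[cite: MochizukiAbsTopIII2015, Definition 3.5 (v) p.77] -/
theorem SelfEquivalence.isEquivalence_app (Φ : D.SelfEquivalence) (a : V) :
    (Φ.hom.app a).IsEquivalence :=
  Φ.isEquivalence.isEquivalence_app a

/-! ### Edge-rigidity: an equivalence is determined by `Φ_Γ⃗` and the vertex functors `Φ_v` -/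

/-- Over an **edge-rigid** `𝒟`, a 1-morphism `Φ` whose vertex functors are fully faithful is
determined, among 1-morphisms over the same `Φ_Γ⃗`, by its vertex functors: if `Φ'_v = Φ_v` for all
`v` then `Φ' = Φ` (the edge 2-cells agree, two of them differing by an automorphism of the rigid
functor `𝒟_e ⋙ Φ_{v₂}`). [cite: MochizukiAbsTopIII2015, Definition 3.5 (v) p.77] -/
theorem OneMorphism.ext_of_isEdgeRigid (hD : D.IsEdgeRigid) {Φ Φ' : OneMorphism F D D'}
    (hfull : ∀ a, (Φ.app a).Full) (hfaithful : ∀ a, (Φ.app a).Faithful)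
    (happ : Φ.app = Φ'.app) : Φ = Φ' := by
  obtain ⟨app, iso⟩ := Φ
  obtain ⟨app', iso'⟩ := Φ'
  dsimp only at hfull hfaithful happ
  subst happ
  suffices hiso : @iso = @iso' by cases hiso; rfl
  funext a b e
  haveI := hfull b
  haveI := hfaithful b
  have hrig : IsRigidFunctor (D.map e ⋙ app b) := (hD e).comp_full_faithful (app b)
  have h : (iso e).inv ≫ (iso' e).hom = 𝟙 _ := congrArg Iso.hom (hrig ((iso e).symm ≪≫ iso' e))
  rw [Iso.inv_comp_eq, Category.comp_id] at h
  exact (Iso.ext h).symm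

/-- **Def 3.5 (v) p.77: "if `𝒟` is edge-rigid, then any equivalence `Φ : 𝒟 ⥲ 𝒟'` is completely
determined by `Φ_Γ⃗` and the `{Φ_v}`"** — two 1-morphisms over the same morphism of graphs with the
same vertex functors, one of which is an equivalence, are equal.
[cite: MochizukiAbsTopIII2015, Definition 3.5 (v) p.77] -/
theorem OneMorphism.IsEquivalence.ext_of_isEdgeRigid (hD : D.IsEdgeRigid)
    {Φ Φ' : OneMorphism F D D'} (hΦ : Φ.IsEquivalence) (happ : Φ.app = Φ'.app) : Φ = Φ' :=
  OneMorphism.ext_of_isEdgeRigid hD (fun a => (hΦ.isEquivalence_app a).full)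
    (fun a => (hΦ.isEquivalence_app a).faithful) happ

/-- Edge-rigidity for self-equivalences: a self-equivalence of an edge-rigid `𝒟` is determined by
its morphism of graphs and its vertex functors. [cite: MochizukiAbsTopIII2015, Definition 3.5 (v) p.77] -/
theorem SelfEquivalence.ext_of_isEdgeRigid (hD : D.IsEdgeRigid) {Φ Ψ : D.SelfEquivalence}
    (hgraph : Φ.graphMap = Ψ.graphMap) (happ : ∀ a, HEq (Φ.hom.app a) (Ψ.hom.app a)) : Φ = Ψ := by
  obtain ⟨G₁, φ, hφ⟩ := Φ
  obtain ⟨G₂, ψ, hψ⟩ := Ψ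
  dsimp only at hgraph happ
  subst hgraph
  obtain rfl : φ = ψ :=
    OneMorphism.IsEquivalence.ext_of_isEdgeRigid hD hφ (funext fun a => eq_of_heq (happ a))
  rfl

/-! ### Vertex-rigidity: 2-isomorphisms between equivalences are unique -/

/-- Two 2-morphisms with the same components are equal. [cite: MochizukiAbsTopIII2015, Definition 3.5 (v) p.76] -/
theorem TwoMorphism.ext' {Φ Ψ : OneMorphism F D D'} {Θ Θ' : TwoMorphism Φ Ψ}
    (h : ∀ a, Θ.app a = Θ'.app a) : Θ = Θ' := by
  obtain ⟨app, nat⟩ := Θ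
  obtain ⟨app', nat'⟩ := Θ'
  obtain rfl : app = app' := funext h
  rfl

/-- Over a **vertex-rigid** `𝒟`, every 2-automorphism of an equivalence `Φ` is the identity: `Φ_v`
is an equivalence of categories out of the id-rigid `𝒟_v`, hence a rigid functor.
[cite: MochizukiAbsTopIII2015, Definition 3.5 (v) p.77] -/
theorem TwoMorphism.IsIso.app_eq_id_of_isVertexRigid (hD : D.IsVertexRigid)
    {Φ : OneMorphism F D D'} (hΦ : Φ.IsEquivalence) {Θ : TwoMorphism Φ Φ} (hΘ : Θ.IsIso) (a : V) :
    Θ.app a = 𝟙 (Φ.app a) := by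
  haveI := hΘ a
  haveI := hΦ.isEquivalence_app a
  exact congrArg Iso.hom (isRigidFunctor_of_full_faithful (Φ.app a) (hD a) (asIso (Θ.app a)))

/-- **Def 3.5 (v) p.77, uniqueness: over a vertex-rigid `𝒟`, any two 2-isomorphisms `Φ ⥲ Ψ` out
of an equivalence `Φ` coincide** (their "ratio" is a 2-automorphism of `Φ`).
[cite: MochizukiAbsTopIII2015, Definition 3.5 (v) p.77] -/
theorem TwoMorphism.IsIso.eq_of_isVertexRigid (hD : D.IsVertexRigid) {Φ Ψ : OneMorphism F D D'}
    (hΦ : Φ.IsEquivalence) {Θ Θ' : TwoMorphism Φ Ψ} (hΘ : Θ.IsIso) (hΘ' : Θ'.IsIso) : Θ = Θ' := by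
  refine TwoMorphism.ext' fun a => ?_
  haveI := hΘ a
  haveI := hΘ' a
  haveI := hΦ.isEquivalence_app a
  have h : Θ.app a ≫ inv (Θ'.app a) = 𝟙 _ :=
    congrArg Iso.hom (isRigidFunctor_of_full_faithful (Φ.app a) (hD a)
      (asIso (Θ.app a) ≪≫ (asIso (Θ'.app a)).symm))
  rw [IsIso.comp_inv_eq, Category.id_comp] at h
  exact h

/-- **Def 3.5 (v) p.77: "if `𝒟` is vertex-rigid, then any two isomorphic equivalences
`Φ, Ψ : 𝒟 ⥲ 𝒟'` admit a unique [2-]isomorphism `Φ ⥲ Ψ`."**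
[cite: MochizukiAbsTopIII2015, Definition 3.5 (v) p.77] -/
theorem OneMorphism.Isomorphic.existsUnique_of_isVertexRigid (hD : D.IsVertexRigid)
    {Φ Ψ : OneMorphism F D D'} (hΦ : Φ.IsEquivalence) (h : Φ.Isomorphic Ψ) :
    ∃! Θ : TwoMorphism Φ Ψ, Θ.IsIso := by
  obtain ⟨Θ, hΘ⟩ := h
  exact ⟨Θ, hΘ, fun Θ' hΘ' => TwoMorphism.IsIso.eq_of_isVertexRigid hD hΦ hΘ' hΘ⟩

/-- Vertex-rigidity for self-equivalences: every 2-automorphism of a self-equivalence of a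
vertex-rigid `𝒟` is the identity. [cite: MochizukiAbsTopIII2015, Definition 3.5 (v) p.77] -/
theorem SelfEquivalence.twoMorphism_app_eq_id_of_isVertexRigid (hD : D.IsVertexRigid)
    (Φ : D.SelfEquivalence) {Θ : TwoMorphism Φ.hom Φ.hom} (hΘ : Θ.IsIso) (a : V) :
    Θ.app a = 𝟙 (Φ.hom.app a) :=
  TwoMorphism.IsIso.app_eq_id_of_isVertexRigid hD Φ.isEquivalence hΘ a

/-- **"In particular, if `𝒟` is vertex-rigid, then it is natural to speak of the automorphism group
`Aut(𝒟)`"**: two self-equivalences with the same class in `Aut(𝒟)` have the same morphism of graphs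
and are related, after transport along that equality, by a UNIQUE 2-isomorphism.
[cite: MochizukiAbsTopIII2015, Definition 3.5 (v) p.77] -/
theorem Aut.existsUnique_twoIso_of_mk_eq (hD : D.IsVertexRigid) {Φ Ψ : D.SelfEquivalence}
    (h : Aut.mk Φ = Aut.mk Ψ) :
    ∃ hG : Φ.graphMap = Ψ.graphMap, ∃! Θ : TwoMorphism (hG ▸ Φ.hom) Ψ.hom, Θ.IsIso := by
  obtain ⟨G₁, φ, hφ⟩ := Φ
  obtain ⟨G₂, ψ, hψ⟩ := Ψ
  obtain ⟨hG, hiso⟩ := Aut.mk_eq_mk.mp h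
  dsimp only at hG hiso ⊢
  subst hG
  exact ⟨rfl, hiso.existsUnique_of_isVertexRigid hD hφ⟩

end DiagramOfCategories

end Literature.AnabelianGeometry.AbsoluteAnabelian
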